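import Literature.Analysis.FluidPDE.HeatGradDivCorrector
import Literature.Analysis.FunctionSpaces.WeakLpQuantitative
import HarnessLib

/-!
# The splitting of bounded weak-`L³` data and its divergence-free caloric field

Analysis/FluidPDE support file (theorems only) on the discharge path of
`Literature.Analysis.FluidPDE.AlbrittonBarker2019_liouville_weakL3_backward`, step "initial
layer for weak-`L³` data" (Barker–Seregin–Šverák, arXiv:1603.03211, Lemma 3.4 with the splitting
Lemma 2.1). For a bounded, strongly measurable, weakly divergence-free `u₀ : ℝ³ → ℝ³` with
`‖u₀‖_{L^{3,∞}}³ ≤ M` and a height `N > 0`: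

* `weakL3_splitting` — `u₀ = ḡ + g̃` with `ḡ = u₀ 𝟙_{|u₀| ≤ N}`, `g̃ = u₀ 𝟙_{|u₀| > N}`,
  `|ḡ| ≤ N`, `ḡ ∈ L^{10/3}` with `‖ḡ‖_{10/3} ≤ (10 N^{1/3} M)^{3/10}`, `g̃ ∈ L²` with
  `‖g̃‖₂ ≤ (3M/N)^{1/2}` (loc. cit., Lemma 2.1 with `(s, r, t) = (10/3, 3, 2)`);
* the **divergence-free caloric field** `E(t) = e^{tΔ}ḡ + ∫_{σ>t} ∇div e^{σΔ}ḡ dσ` of the large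
  piece: `isDivFree_caloricField`, `contDiff_caloricField`, `continuousOn_caloricField_uncurry`,
  `hasDerivAt_caloricField` (classical heat equation), and the bounds
  `‖∇E(t)‖_∞ ≤ C t^{-19/20} ‖ḡ‖_{10/3}`, `‖E(t)‖₄ ≤ C t^{-3/40}‖ḡ‖_{10/3}`,
  `‖∇E(t)‖₄ ≤ C t^{-23/40}‖ḡ‖_{10/3}` (`caloricField_bounds`);
* the **remainder** `W̃(t) = e^{tΔ}u₀ - E(t) = e^{tΔ}g̃ - ∫_{σ>t} ∇div e^{σΔ}ḡ dσ` is in `L²`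
  uniformly, `‖W̃(t)‖₂ ≤ (2‖tr‖² + 3)‖g̃‖₂` (`eLpNorm_heatExtension_sub_caloricField_le`).

## References

* T. Barker, G. Seregin, V. Šverák, *On stability of weak Navier–Stokes solutions with large
  `L^{3,∞}` initial data*, Comm. PDE 43 (2018) = arXiv:1603.03211, Lemma 2.1, Lemma 3.4.
  [`BarkerSeregin2016`]
-/

noncomputable section

open MeasureTheory Set Function Filter Metric TopologicalSpace InnerProductSpace
open _root_.Topology
open scoped NNReal ENNReal Laplacian RealInnerProductSpace

namespace Literature.Analysis.FluidPDE

open UnboundedOperators FunctionSpaces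

/-! ### Numerical exponents on `ℝ³` -/

/-- `(1/(10/3))` as a real number. [folklore] -/
theorem toReal_one_div_ten_thirds : (1 / (10 / 3 : ℝ≥0∞)).toReal = 3 / 10 := by
  rw [one_div, ENNReal.toReal_inv, ENNReal.toReal_div]; norm_num

/-- `(1/4)` as a real number. [folklore] -/
theorem toReal_one_div_four : (1 / (4 : ℝ≥0∞)).toReal = 1 / 4 := by
  rw [one_div, ENNReal.toReal_inv]; norm_num

/-- `1 ≤ 10/3 < 4`, `3 < 10/3`, `10/3 ≠ ∞` in `ℝ≥0∞`. [folklore] -/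
theorem ten_thirds_facts : (1 : ℝ≥0∞) ≤ 10 / 3 ∧ (10 / 3 : ℝ≥0∞) < 4 ∧ (3 : ℝ≥0∞) < 10 / 3 ∧
    (10 / 3 : ℝ≥0∞) ≠ ∞ ∧ (10 / 3 : ℝ≥0∞).toReal = 10 / 3 := by
  refine ⟨?_, ?_, ?_, ENNReal.div_ne_top (by norm_num) (by norm_num), ?_⟩
  · rw [ENNReal.le_div_iff_mul_le (by norm_num) (by norm_num)]; norm_num
  · rw [ENNReal.div_lt_iff (by norm_num) (by norm_num)]; norm_num
  · rw [ENNReal.lt_div_iff_mul_lt (by norm_num) (by norm_num)]; norm_num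
  · rw [ENNReal.toReal_div]; norm_num

/-! ### The splitting of bounded weak-`L³` data -/

section Splitting

variable {u₀ : EuclideanSpace ℝ (Fin 3) → EuclideanSpace ℝ (Fin 3)}

/-- **Splitting of bounded weak-`L³` data at height `N`** (Barker–Seregin–Šverák 2016,
Lemma 2.1 with `(s, r, t) = (10/3, 3, 2)`): `u₀ = ḡ + g̃`, `ḡ = u₀ 𝟙_{|u₀| ≤ N}` bounded by `N`
and by `sup|u₀|`, strongly measurable, in `L^{10/3}` with `‖ḡ‖^{10/3}_{10/3} ≤ 10 N^{1/3} M`;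
`g̃ = u₀ 𝟙_{|u₀|>N}` bounded by `sup|u₀|`, in `L²` with `‖g̃‖₂² ≤ 3M/N`. [cite: BarkerSeregin2016, Lemma 2.1] -/
theorem weakL3_splitting (hu₀ : StronglyMeasurable u₀) {K : ℝ} (hK : ∀ x, ‖u₀ x‖ ≤ K)
    {M : ℝ≥0} (hM : eWeakLpPow u₀ 3 volume ≤ M) {N : ℝ} (hN : 0 < N) :
    ∃ gb gt : EuclideanSpace ℝ (Fin 3) → EuclideanSpace ℝ (Fin 3),
      (∀ x, u₀ x = gb x + gt x) ∧ StronglyMeasurable gb ∧ StronglyMeasurable gt ∧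
      (∀ x, ‖gb x‖ ≤ N) ∧ (∀ x, ‖gb x‖ ≤ K) ∧ (∀ x, ‖gt x‖ ≤ K) ∧
      MemLp gb (10 / 3) volume ∧
      (eLpNorm gb (10 / 3) volume).toReal ≤ (10 * N ^ (1 / 3 : ℝ) * (M : ℝ)) ^ (3 / 10 : ℝ) ∧
      MemLp gt 2 volume ∧
      (eLpNorm gt 2 volume).toReal ≤ (3 / N * (M : ℝ)) ^ (1 / 2 : ℝ) := by
  set gb : EuclideanSpace ℝ (Fin 3) → EuclideanSpace ℝ (Fin 3) := {x | ‖u₀ x‖ ≤ N}.indicator u₀ with hgb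
  set gt : EuclideanSpace ℝ (Fin 3) → EuclideanSpace ℝ (Fin 3) := {x | N < ‖u₀ x‖}.indicator u₀ with hgt
  have hAm : MeasurableSet {x | N < ‖u₀ x‖} := measurableSet_lt measurable_const hu₀.measurable.norm
  have hBm : MeasurableSet {x | ‖u₀ x‖ ≤ N} := measurableSet_le hu₀.measurable.norm measurable_const
  have hgbm : StronglyMeasurable gb := hu₀.indicator hBm
  have hgtm : StronglyMeasurable gt := hu₀.indicator hAm
  have hsum : ∀ x, u₀ x = gb x + gt x := fun x => by
    have h := congrFun (indicator_lt_norm_add_indicator_norm_le u₀ N) x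
    simp only [Pi.add_apply] at h
    rw [hgb, hgt, ← h, add_comm]
  have hgbN : ∀ x, ‖gb x‖ ≤ N := fun x => norm_indicator_norm_le_le u₀ hN.le x
  have hgbK : ∀ x, ‖gb x‖ ≤ K := fun x => (norm_indicator_le_norm_self _ x).trans (hK x)
  have hgtK : ∀ x, ‖gt x‖ ≤ K := fun x => (norm_indicator_le_norm_self _ x).trans (hK x)
  obtain ⟨h1, h4, h3, htop, htoReal⟩ := ten_thirds_facts
  -- the `L^{10/3}` bound of the bounded piece
  have hgb_lint : ∫⁻ x, ‖gb x‖ₑ ^ (10 / 3 : ℝ) ≤ ENNReal.ofReal (10 * N ^ (1 / 3 : ℝ)) * M := by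
    have h := MemWeakLp.lintegral_rpow_indicator_norm_le_le (p := 3) (μ := volume) hu₀.aestronglyMeasurable
      hBm (q := 10 / 3) (by rw [ENNReal.toReal_ofNat]; norm_num) hN
    simp only [ENNReal.toReal_ofNat] at h
    refine h.trans ?_
    have e1 : (10 / 3 : ℝ) / (10 / 3 - 3) * N ^ ((10 / 3 : ℝ) - 3) = 10 * N ^ (1 / 3 : ℝ) := by norm_num
    rw [e1]
    exact mul_le_mul' le_rfl hM
  have hgb_mem : MemLp gb (10 / 3) volume := by
    refine ⟨hgbm.aestronglyMeasurable, ?_⟩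
    rw [eLpNorm_eq_lintegral_rpow_enorm_toReal (by norm_num) htop, htoReal]
    refine ENNReal.rpow_lt_top_of_nonneg (by norm_num) (lt_of_le_of_lt hgb_lint ?_).ne
    exact ENNReal.mul_lt_top ENNReal.ofReal_lt_top ENNReal.coe_lt_top
  have hgb_norm : (eLpNorm gb (10 / 3) volume).toReal ≤ (10 * N ^ (1 / 3 : ℝ) * (M : ℝ)) ^ (3 / 10 : ℝ) := by
    rw [eLpNorm_eq_lintegral_rpow_enorm_toReal (by norm_num) htop, htoReal, ← ENNReal.toReal_rpow]
    have hfin : (∫⁻ x, ‖gb x‖ₑ ^ (10 / 3 : ℝ)) ≠ ∞ :=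
      (lt_of_le_of_lt hgb_lint (ENNReal.mul_lt_top ENNReal.ofReal_lt_top ENNReal.coe_lt_top)).ne
    have hle : (∫⁻ x, ‖gb x‖ₑ ^ (10 / 3 : ℝ)).toReal ≤ 10 * N ^ (1 / 3 : ℝ) * (M : ℝ) := by
      have h := ENNReal.toReal_mono (ENNReal.mul_ne_top ENNReal.ofReal_ne_top ENNReal.coe_ne_top) hgb_lint
      rwa [ENNReal.toReal_mul, ENNReal.toReal_ofReal (by positivity), ENNReal.coe_toReal] at h
    rw [show (1 / (10 / 3 : ℝ)) = 3 / 10 by norm_num]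
    exact Real.rpow_le_rpow ENNReal.toReal_nonneg hle (by norm_num)
  -- the `L²` bound of the unbounded piece
  have hgt_lint : ∫⁻ x, ‖gt x‖ₑ ^ (2 : ℝ) ≤ ENNReal.ofReal (3 / N) * M := by
    have h := MemWeakLp.lintegral_rpow_indicator_lt_norm_le (p := 3) (μ := volume) hu₀.aestronglyMeasurable
      hAm (r := 2) zero_lt_two (by rw [ENNReal.toReal_ofNat]; norm_num) hN
    simp only [ENNReal.toReal_ofNat] at h
    refine h.trans ?_
    have e1 : (3 : ℝ) / (3 - 2) * N ^ ((2 : ℝ) - 3) = 3 / N := by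
      rw [show (2 : ℝ) - 3 = -1 by norm_num, Real.rpow_neg_one]; field_simp; norm_num
    rw [e1]
    exact mul_le_mul' le_rfl hM
  have hgt_mem : MemLp gt 2 volume := by
    refine ⟨hgtm.aestronglyMeasurable, ?_⟩
    rw [eLpNorm_eq_lintegral_rpow_enorm_toReal (by norm_num) (by norm_num), ENNReal.toReal_ofNat]
    refine ENNReal.rpow_lt_top_of_nonneg (by norm_num) (lt_of_le_of_lt hgt_lint ?_).ne
    exact ENNReal.mul_lt_top ENNReal.ofReal_lt_top ENNReal.coe_lt_top
  have hgt_norm : (eLpNorm gt 2 volume).toReal ≤ (3 / N * (M : ℝ)) ^ (1 / 2 : ℝ) := by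
    rw [eLpNorm_eq_lintegral_rpow_enorm_toReal (by norm_num) (by norm_num), ENNReal.toReal_ofNat,
      ← ENNReal.toReal_rpow]
    have hle : (∫⁻ x, ‖gt x‖ₑ ^ (2 : ℝ)).toReal ≤ 3 / N * (M : ℝ) := by
      have h := ENNReal.toReal_mono (ENNReal.mul_ne_top ENNReal.ofReal_ne_top ENNReal.coe_ne_top) hgt_lint
      rwa [ENNReal.toReal_mul, ENNReal.toReal_ofReal (by positivity), ENNReal.coe_toReal] at h
    exact Real.rpow_le_rpow ENNReal.toReal_nonneg hle (by norm_num)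
  exact ⟨gb, gt, hsum, hgbm, hgtm, hgbN, hgbK, hgtK, hgb_mem, hgb_norm, hgt_mem, hgt_norm⟩

end Splitting

/-! ### The divergence-free caloric field of the large piece -/

section Field

variable {gb : EuclideanSpace ℝ (Fin 3) → EuclideanSpace ℝ (Fin 3)} {N : ℝ}

/-- **The field `E(t) = e^{tΔ}ḡ + ∫_{σ>t} ∇div e^{σΔ}ḡ dσ` is divergence free** for `t > 0`
(`div` of the corrector is `-div e^{tΔ}ḡ`). [cite: BarkerSeregin2016, Lemma 2.1 & Lemma 3.4] -/
theorem isDivFree_caloricField (hgb : MemLp gb (10 / 3) volume) (hN : ∀ z, ‖gb z‖ ≤ N) {t : ℝ}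
    (ht : 0 < t) :
    VectorCalculus.IsDivFree (fun x => heatExtension gb t x +
      ∫ σ in Ioi t, gradient (VectorCalculus.divergence (heatExtension gb σ)) x) := by
  obtain ⟨h1, -, -, htop, -⟩ := ten_thirds_facts
  intro x
  have hd₁ : DifferentiableAt ℝ (heatExtension gb t) x :=
    ((contDiff_heatExtension_holds hgb h1 ht).differentiable (by simp)) x
  have hd₂ : DifferentiableAt ℝ
      (fun y => ∫ σ in Ioi t, gradient (VectorCalculus.divergence (heatExtension gb σ)) y) x :=
    ((integral_gradDiv_heatExtension_Ioi_smooth hgb h1 htop hN ht).1.differentiable (by simp)) x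
  rw [divergence_add_apply hd₁ hd₂, divergence_integral_gradDiv_heatExtension_Ioi hgb h1 htop hN ht x,
    add_neg_cancel]

/-- `E(t)` is smooth in space. [folklore] -/
theorem contDiff_caloricField (hgb : MemLp gb (10 / 3) volume) (hN : ∀ z, ‖gb z‖ ≤ N) {t : ℝ}
    (ht : 0 < t) :
    ContDiff ℝ (⊤ : ℕ∞) (fun x => heatExtension gb t x +
      ∫ σ in Ioi t, gradient (VectorCalculus.divergence (heatExtension gb σ)) x) := by
  obtain ⟨h1, -, -, htop, -⟩ := ten_thirds_facts
  exact (contDiff_heatExtension_holds hgb h1 ht).add (integral_gradDiv_heatExtension_Ioi_smooth hgb h1 htop hN ht).1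

/-- **Joint continuity of `E`, `DE`, `ΔE` on `(0,∞) × ℝ³`.** [folklore] -/
theorem continuousOn_caloricField_uncurry (hgb : MemLp gb (10 / 3) volume) (hN : ∀ z, ‖gb z‖ ≤ N) :
    ContinuousOn (fun q : ℝ × EuclideanSpace ℝ (Fin 3) => heatExtension gb q.1 q.2 +
      ∫ σ in Ioi q.1, gradient (VectorCalculus.divergence (heatExtension gb σ)) q.2) (Ioi 0 ×ˢ univ) ∧
    ContinuousOn (fun q : ℝ × EuclideanSpace ℝ (Fin 3) => fderiv ℝ (fun x => heatExtension gb q.1 x +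
      ∫ σ in Ioi q.1, gradient (VectorCalculus.divergence (heatExtension gb σ)) x) q.2) (Ioi 0 ×ˢ univ) ∧
    ContinuousOn (fun q : ℝ × EuclideanSpace ℝ (Fin 3) => (Δ (fun x => heatExtension gb q.1 x +
      ∫ σ in Ioi q.1, gradient (VectorCalculus.divergence (heatExtension gb σ)) x)) q.2) (Ioi 0 ×ˢ univ) := by
  obtain ⟨h1, -, -, htop, -⟩ := ten_thirds_facts
  obtain ⟨hG0, hG1, hG2⟩ := continuousOn_integral_gradDiv_Ioi_uncurry hgb h1 htop hN
  refine ⟨(continuousOn_uncurry_heatExtension_of_memLp hgb h1).add hG0, ?_, ?_⟩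
  · have hV : ContinuousOn (fun q : ℝ × EuclideanSpace ℝ (Fin 3) => fderiv ℝ (heatExtension gb q.1) q.2)
        (Ioi 0 ×ˢ univ) :=
      continuousOn_clm_apply.2 fun v => continuousOn_uncurry_fderiv_heatExtension_of_memLp hgb h1 v
    refine (hV.add hG1).congr fun q hq => ?_
    obtain ⟨hq1, -⟩ := mem_prod.1 hq
    have ht : 0 < q.1 := hq1
    have hd₁ : DifferentiableAt ℝ (heatExtension gb q.1) q.2 :=
      ((contDiff_heatExtension_holds hgb h1 ht).differentiable (by simp)) q.2
    have hd₂ : DifferentiableAt ℝ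
        (fun y => ∫ σ in Ioi q.1, gradient (VectorCalculus.divergence (heatExtension gb σ)) y) q.2 :=
      ((integral_gradDiv_heatExtension_Ioi_smooth hgb h1 htop hN ht).1.differentiable (by simp)) q.2
    exact fderiv_fun_add hd₁ hd₂
  · have hV : ContinuousOn (fun q : ℝ × EuclideanSpace ℝ (Fin 3) => (Δ (heatExtension gb q.1)) q.2)
        (Ioi 0 ×ˢ univ) := continuousOn_uncurry_laplacian_heatExtension_of_memLp hgb h1
    refine (hV.add hG2).congr fun q hq => ?_
    obtain ⟨hq1, -⟩ := mem_prod.1 hq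
    have ht : 0 < q.1 := hq1
    have hc₁ : ContDiff ℝ 2 (heatExtension gb q.1) := contDiff_infty.1 (contDiff_heatExtension_holds hgb h1 ht) 2
    have hc₂ : ContDiff ℝ 2
        (fun y => ∫ σ in Ioi q.1, gradient (VectorCalculus.divergence (heatExtension gb σ)) y) :=
      contDiff_infty.1 (integral_gradDiv_heatExtension_Ioi_smooth hgb h1 htop hN ht).1 2
    exact hc₁.contDiffAt.laplacian_add hc₂.contDiffAt

/-- **`E` solves the heat equation classically**: `∂_t E(t)(x) = ΔE(t)(x)` for `t > 0`. [cite: Folland1995PDE, §4.A Theorem (4.3)] -/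
theorem hasDerivAt_caloricField (hgb : MemLp gb (10 / 3) volume) (hN : ∀ z, ‖gb z‖ ≤ N) {t : ℝ}
    (ht : 0 < t) (x : EuclideanSpace ℝ (Fin 3)) :
    HasDerivAt (fun s => heatExtension gb s x +
        ∫ σ in Ioi s, gradient (VectorCalculus.divergence (heatExtension gb σ)) x)
      ((Δ (fun y => heatExtension gb t y +
        ∫ σ in Ioi t, gradient (VectorCalculus.divergence (heatExtension gb σ)) y)) x) t := by
  obtain ⟨h1, -, -, htop, -⟩ := ten_thirds_facts
  have hc₁ : ContDiff ℝ 2 (heatExtension gb t) := contDiff_infty.1 (contDiff_heatExtension_holds hgb h1 ht) 2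
  have hc₂ : ContDiff ℝ 2 (fun y => ∫ σ in Ioi t, gradient (VectorCalculus.divergence (heatExtension gb σ)) y) :=
    contDiff_infty.1 (integral_gradDiv_heatExtension_Ioi_smooth hgb h1 htop hN ht).1 2
  have hlap : (Δ (fun y => heatExtension gb t y +
        ∫ σ in Ioi t, gradient (VectorCalculus.divergence (heatExtension gb σ)) y)) x =
      (Δ (heatExtension gb t)) x +
        (Δ (fun y => ∫ σ in Ioi t, gradient (VectorCalculus.divergence (heatExtension gb σ)) y)) x :=
    hc₁.contDiffAt.laplacian_add hc₂.contDiffAt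
  rw [hlap]
  exact (hasDerivAt_heatExtension_time ht hgb h1 x).add (hasDerivAt_integral_gradDiv_Ioi hgb h1 htop hN ht x)

/-- **Bounds of the divergence-free caloric field** (all constants absolute; `A = ‖ḡ‖_{10/3}`):
`‖E(t)(x)‖ ≤ N + C t^{-9/20} A`, `‖DE(t)(x)‖ ≤ C t^{-19/20} A`, `E(t) ∈ L⁴` with
`‖E(t)‖₄ ≤ C t^{-3/40} A`, `‖DE(t)‖₄ ≤ C t^{-23/40} A` (`L^{10/3} → L^∞, L⁴` smoothing of the heat
semigroup and of the corrector). [cite: GigaGigaSaal2010, §1.1.3] -/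
theorem caloricField_bounds :
    ∃ C : ℝ, 0 ≤ C ∧ ∀ (gb : EuclideanSpace ℝ (Fin 3) → EuclideanSpace ℝ (Fin 3)) (N : ℝ),
      MemLp gb (10 / 3) volume → (∀ z, ‖gb z‖ ≤ N) → ∀ t : ℝ, 0 < t →
      (∀ x, ‖heatExtension gb t x + ∫ σ in Ioi t, gradient (VectorCalculus.divergence (heatExtension gb σ)) x‖ ≤
        N + C * t ^ (-(9 / 20 : ℝ)) * (eLpNorm gb (10 / 3) volume).toReal) ∧
      (∀ x, ‖fderiv ℝ (fun y => heatExtension gb t y +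
          ∫ σ in Ioi t, gradient (VectorCalculus.divergence (heatExtension gb σ)) y) x‖ ≤
        C * t ^ (-(19 / 20 : ℝ)) * (eLpNorm gb (10 / 3) volume).toReal) ∧
      MemLp (fun x => heatExtension gb t x +
          ∫ σ in Ioi t, gradient (VectorCalculus.divergence (heatExtension gb σ)) x) 4 volume ∧
      eLpNorm (fun x => heatExtension gb t x +
          ∫ σ in Ioi t, gradient (VectorCalculus.divergence (heatExtension gb σ)) x) 4 volume ≤
        ENNReal.ofReal (C * t ^ (-(3 / 40 : ℝ))) * eLpNorm gb (10 / 3) volume ∧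
      eLpNorm (fderiv ℝ (fun x => heatExtension gb t x +
          ∫ σ in Ioi t, gradient (VectorCalculus.divergence (heatExtension gb σ)) x)) 4 volume ≤
        ENNReal.ofReal (C * t ^ (-(23 / 40 : ℝ))) * eLpNorm gb (10 / 3) volume := by
  obtain ⟨h1, h4, h3, htop, htoReal⟩ := ten_thirds_facts
  have hE3 : (Module.finrank ℝ (EuclideanSpace ℝ (Fin 3)) : ℝ) = 3 := by
    rw [finrank_euclideanSpace_fin]; norm_num
  -- the six constants
  obtain ⟨C₀, hC₀0, hC₀⟩ := norm_integral_gradDiv_heatExtension_Ioi_le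
    (E := EuclideanSpace ℝ (Fin 3)) (p := 10 / 3) h1 htop
  obtain ⟨C₁, hC₁⟩ := exists_eLpNorm_fderiv_heatExtension_le_rpow
    (E := EuclideanSpace ℝ (Fin 3)) (F := EuclideanSpace ℝ (Fin 3)) h1 (le_top : (10 / 3 : ℝ≥0∞) ≤ ⊤)
  obtain ⟨C₂, hC₂0, hC₂⟩ := norm_fderiv_integral_gradDiv_Ioi_le
    (E := EuclideanSpace ℝ (Fin 3)) (p := 10 / 3) h1 htop
  obtain ⟨C₃, hC₃⟩ := eLpNorm_heatExtension_le_rpow_holds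
    (E := EuclideanSpace ℝ (Fin 3)) (F := EuclideanSpace ℝ (Fin 3)) h1 h4.le
  obtain ⟨C₄, hC₄⟩ := eLpNorm_integral_gradDiv_Ioi_le_of_lt
    (E := EuclideanSpace ℝ (Fin 3)) (p := 10 / 3) h1 h4 (by norm_num)
  obtain ⟨C₅, hC₅⟩ := exists_eLpNorm_fderiv_heatExtension_le_rpow
    (E := EuclideanSpace ℝ (Fin 3)) (F := EuclideanSpace ℝ (Fin 3)) h1 h4.le
  obtain ⟨C₆, hC₆⟩ := eLpNorm_fderiv_integral_gradDiv_Ioi_le_of_lt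
    (E := EuclideanSpace ℝ (Fin 3)) (p := 10 / 3) h1 h4 (by norm_num)
  -- the numerical exponents
  have eθ : (1 / (10 / 3 : ℝ≥0∞)).toReal = 3 / 10 := toReal_one_div_ten_thirds
  have e4 : (1 / (4 : ℝ≥0∞)).toReal = 1 / 4 := toReal_one_div_four
  have etop : (1 / (⊤ : ℝ≥0∞)).toReal = 0 := by simp
  refine ⟨max (max (max C₀ (C₁ + C₂)) ((C₃ : ℝ) + C₄)) ((C₅ : ℝ) + C₆), by positivity,
    fun gb N hgb hN t ht => ?_⟩
  set A : ℝ := (eLpNorm gb (10 / 3) volume).toReal with hA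
  have hA0 : 0 ≤ A := ENNReal.toReal_nonneg
  set Cm : ℝ := max (max (max C₀ (C₁ + C₂)) ((C₃ : ℝ) + C₄)) ((C₅ : ℝ) + C₆) with hCm
  have hC₀le : C₀ ≤ Cm := le_trans (le_max_left _ _) (le_trans (le_max_left _ _) (le_max_left _ _))
  have hC12le : C₁ + C₂ ≤ Cm := le_trans (le_max_right _ _) (le_trans (le_max_left _ _) (le_max_left _ _))
  have hC34le : (C₃ : ℝ) + C₄ ≤ Cm := le_trans (le_max_right _ _) (le_max_left _ _)
  have hC56le : (C₅ : ℝ) + C₆ ≤ Cm := le_max_right _ _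
  obtain ⟨-, -, hG0⟩ := hC₀ gb hgb N hN t ht
  have hsmV : ContDiff ℝ (⊤ : ℕ∞) (heatExtension gb t) := contDiff_heatExtension_holds hgb h1 ht
  have hsmG := (integral_gradDiv_heatExtension_Ioi_smooth hgb h1 htop hN ht).1
  have hdV : ∀ x, DifferentiableAt ℝ (heatExtension gb t) x := fun x => (hsmV.differentiable (by simp)) x
  have hdG : ∀ x, DifferentiableAt ℝ
      (fun y => ∫ σ in Ioi t, gradient (VectorCalculus.divergence (heatExtension gb σ)) y) x := fun x =>
    (hsmG.differentiable (by simp)) x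
  refine ⟨fun x => ?_, fun x => ?_, ?_, ?_, ?_⟩
  · -- sup bound of `E`
    have hV : ‖heatExtension gb t x‖ ≤ N := norm_heatExtension_le_of_bound hN ht x
    have hG := hG0 x
    rw [hE3, eθ] at hG
    have e1 : -((3 : ℝ) / 2 * (3 / 10)) = -(9 / 20 : ℝ) := by norm_num
    rw [e1] at hG
    calc ‖heatExtension gb t x + ∫ σ in Ioi t, gradient (VectorCalculus.divergence (heatExtension gb σ)) x‖
        ≤ N + C₀ * t ^ (-(9 / 20 : ℝ)) * A := (norm_add_le _ _).trans (add_le_add hV hG)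
      _ ≤ N + Cm * t ^ (-(9 / 20 : ℝ)) * A := by gcongr
  · -- sup bound of `DE`
    have hV1 := hC₁ gb hgb t ht
    rw [hE3, eθ, etop] at hV1
    have e1 : -(1 / 2 + (3 : ℝ) / 2 * (3 / 10 - 0)) = -(19 / 20 : ℝ) := by norm_num
    rw [e1] at hV1
    have hVcont : Continuous (fderiv ℝ (heatExtension gb t)) := hsmV.continuous_fderiv (by simp)
    have hfin : (C₁ : ℝ≥0∞) * ENNReal.ofReal (t ^ (-(19 / 20 : ℝ))) * eLpNorm gb (10 / 3) volume ≠ ∞ :=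
      ENNReal.mul_ne_top (ENNReal.mul_ne_top ENNReal.coe_ne_top ENNReal.ofReal_ne_top) hgb.eLpNorm_ne_top
    have hV2 := norm_le_of_eLpNorm_top_le_of_continuous hVcont hfin hV1 x
    rw [ENNReal.toReal_mul, ENNReal.toReal_mul, ENNReal.coe_toReal,
      ENNReal.toReal_ofReal (Real.rpow_nonneg ht.le _)] at hV2
    have hG := hC₂ gb hgb N hN t ht x
    rw [hE3, eθ] at hG
    have e2 : -(1 / 2 + (3 : ℝ) / 2 * (3 / 10)) = -(19 / 20 : ℝ) := by norm_num
    rw [e2] at hG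
    rw [fderiv_fun_add (hdV x) (hdG x)]
    calc ‖fderiv ℝ (heatExtension gb t) x +
          fderiv ℝ (fun y => ∫ σ in Ioi t, gradient (VectorCalculus.divergence (heatExtension gb σ)) y) x‖
        ≤ C₁ * t ^ (-(19 / 20 : ℝ)) * A + C₂ * t ^ (-(19 / 20 : ℝ)) * A := (norm_add_le _ _).trans (add_le_add hV2 hG)
      _ = (C₁ + C₂) * t ^ (-(19 / 20 : ℝ)) * A := by ring
      _ ≤ Cm * t ^ (-(19 / 20 : ℝ)) * A := by gcongr
  · -- `E(t) ∈ L⁴`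
    have hVmem : MemLp (heatExtension gb t) 4 volume := by
      refine ⟨(memLp_heatExtension_holds hgb h1 ht).1, ?_⟩
      refine lt_of_le_of_lt (hC₃ gb hgb t ht) ?_
      exact ENNReal.mul_lt_top (ENNReal.mul_lt_top ENNReal.coe_lt_top ENNReal.ofReal_lt_top) hgb.eLpNorm_lt_top
    exact hVmem.add (hC₄ gb hgb N hN t ht).1
  · -- `L⁴` bound of `E`
    have hV := hC₃ gb hgb t ht
    rw [hE3, eθ, e4] at hV
    have e1 : -((3 : ℝ) / 2) * (3 / 10 - 1 / 4) = -(3 / 40 : ℝ) := by norm_num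
    rw [e1] at hV
    obtain ⟨hGmem, hG⟩ := hC₄ gb hgb N hN t ht
    rw [hE3, eθ, e4] at hG
    have e2 : -((3 : ℝ) / 2 * (3 / 10 - 1 / 4)) = -(3 / 40 : ℝ) := by norm_num
    rw [e2] at hG
    have hVmeas := (memLp_heatExtension_holds hgb h1 ht).1
    calc eLpNorm (fun x => heatExtension gb t x +
          ∫ σ in Ioi t, gradient (VectorCalculus.divergence (heatExtension gb σ)) x) 4 volume
        ≤ eLpNorm (heatExtension gb t) 4 volume +
            eLpNorm (fun x => ∫ σ in Ioi t, gradient (VectorCalculus.divergence (heatExtension gb σ)) x) 4 volume :=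
          eLpNorm_add_le hVmeas hGmem.1 (by norm_num)
      _ ≤ C₃ * ENNReal.ofReal (t ^ (-(3 / 40 : ℝ))) * eLpNorm gb (10 / 3) volume +
            C₄ * ENNReal.ofReal (t ^ (-(3 / 40 : ℝ))) * eLpNorm gb (10 / 3) volume := add_le_add hV hG
      _ = ENNReal.ofReal ((C₃ + C₄) * t ^ (-(3 / 40 : ℝ))) * eLpNorm gb (10 / 3) volume := by
          rw [ENNReal.ofReal_mul (by positivity), ENNReal.ofReal_add (by positivity) (by positivity),
            ENNReal.ofReal_coe_nnreal, ENNReal.ofReal_coe_nnreal]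
          ring
      _ ≤ ENNReal.ofReal (Cm * t ^ (-(3 / 40 : ℝ))) * eLpNorm gb (10 / 3) volume := by
          gcongr
  · -- `L⁴` bound of `DE`
    have hV := hC₅ gb hgb t ht
    rw [hE3, eθ, e4] at hV
    have e1 : -(1 / 2 + (3 : ℝ) / 2 * (3 / 10 - 1 / 4)) = -(23 / 40 : ℝ) := by norm_num
    rw [e1] at hV
    have hG := hC₆ gb hgb N hN t ht
    rw [hE3, eθ, e4] at hG
    rw [e1] at hG
    have hfeq : fderiv ℝ (fun x => heatExtension gb t x +
        ∫ σ in Ioi t, gradient (VectorCalculus.divergence (heatExtension gb σ)) x) =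
        fderiv ℝ (heatExtension gb t) +
          fderiv ℝ (fun y => ∫ σ in Ioi t, gradient (VectorCalculus.divergence (heatExtension gb σ)) y) := by
      funext x; exact fderiv_fun_add (hdV x) (hdG x)
    have hm1 : AEStronglyMeasurable (fderiv ℝ (heatExtension gb t)) volume :=
      (hsmV.continuous_fderiv (by simp)).aestronglyMeasurable
    have hm2 : AEStronglyMeasurable
        (fderiv ℝ (fun y => ∫ σ in Ioi t, gradient (VectorCalculus.divergence (heatExtension gb σ)) y)) volume :=
      (hsmG.continuous_fderiv (by simp)).aestronglyMeasurable
    rw [hfeq]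
    calc eLpNorm (fderiv ℝ (heatExtension gb t) +
          fderiv ℝ (fun y => ∫ σ in Ioi t, gradient (VectorCalculus.divergence (heatExtension gb σ)) y)) 4 volume
        ≤ eLpNorm (fderiv ℝ (heatExtension gb t)) 4 volume +
            eLpNorm (fderiv ℝ (fun y => ∫ σ in Ioi t, gradient (VectorCalculus.divergence (heatExtension gb σ)) y))
              4 volume :=
          eLpNorm_add_le (ε := EuclideanSpace ℝ (Fin 3) →L[ℝ] EuclideanSpace ℝ (Fin 3))
            (μ := (volume : Measure (EuclideanSpace ℝ (Fin 3)))) (p := 4) hm1 hm2 (by norm_num)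
      _ ≤ C₅ * ENNReal.ofReal (t ^ (-(23 / 40 : ℝ))) * eLpNorm gb (10 / 3) volume +
            C₆ * ENNReal.ofReal (t ^ (-(23 / 40 : ℝ))) * eLpNorm gb (10 / 3) volume := add_le_add hV hG
      _ = ENNReal.ofReal ((C₅ + C₆) * t ^ (-(23 / 40 : ℝ))) * eLpNorm gb (10 / 3) volume := by
          rw [ENNReal.ofReal_mul (by positivity), ENNReal.ofReal_add (by positivity) (by positivity),
            ENNReal.ofReal_coe_nnreal, ENNReal.ofReal_coe_nnreal]
          ring
      _ ≤ ENNReal.ofReal (Cm * t ^ (-(23 / 40 : ℝ))) * eLpNorm gb (10 / 3) volume := by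
          gcongr

/-- **The `L²` remainder of the splitting**: for bounded measurable `g̃ ∈ L²` with `ḡ + g̃`
weakly divergence free, `W̃(t) = e^{tΔ}(ḡ + g̃) - E(t) = e^{tΔ}g̃ - ∫_{σ>t}∇div e^{σΔ}ḡ dσ`
pointwise, `W̃(t) ∈ L²` and `‖W̃(t)‖₂ ≤ (2‖tr‖² + 3)‖g̃‖₂` (`L²` contraction of the heat semigroup
and the `L²` bound of the corrector). [cite: BarkerSeregin2016, Lemma 2.1 & Lemma 3.4] -/
theorem eLpNorm_heatExtension_sub_caloricField_le (hgb : MemLp gb (10 / 3) volume) (hN : ∀ z, ‖gb z‖ ≤ N)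
    {gt : EuclideanSpace ℝ (Fin 3) → EuclideanSpace ℝ (Fin 3)} (hgt : MemLp gt 2 volume) {K : ℝ}
    (hK : ∀ z, ‖gt z‖ ≤ K) (hdiv : IsWeaklyDivFree (gb + gt)) {t : ℝ} (ht : 0 < t) :
    (∀ x, heatExtension (gb + gt) t x - (heatExtension gb t x +
        ∫ σ in Ioi t, gradient (VectorCalculus.divergence (heatExtension gb σ)) x) =
      heatExtension gt t x - ∫ σ in Ioi t, gradient (VectorCalculus.divergence (heatExtension gb σ)) x) ∧
    MemLp (fun x => heatExtension gt t x -
      ∫ σ in Ioi t, gradient (VectorCalculus.divergence (heatExtension gb σ)) x) 2 volume ∧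
    eLpNorm (fun x => heatExtension gt t x -
      ∫ σ in Ioi t, gradient (VectorCalculus.divergence (heatExtension gb σ)) x) 2 volume ≤
      ENNReal.ofReal (2 * ‖(traceCLM : (EuclideanSpace ℝ (Fin 3) →L[ℝ] EuclideanSpace ℝ (Fin 3)) →L[ℝ] ℝ)‖ ^ 2 + 3) *
        eLpNorm gt 2 volume := by
  obtain ⟨h1, -, -, htop, -⟩ := ten_thirds_facts
  have hmb : MemLp gb ∞ (volume : Measure (EuclideanSpace ℝ (Fin 3))) :=
    memLp_top_of_bound hgb.1 N (Eventually.of_forall hN)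
  have hmt : MemLp gt ∞ (volume : Measure (EuclideanSpace ℝ (Fin 3))) :=
    memLp_top_of_bound hgt.1 K (Eventually.of_forall hK)
  have hadd : ∀ x, heatExtension (gb + gt) t x = heatExtension gb t x + heatExtension gt t x := fun x =>
    heatExtension_add_apply_of_memLp' hmb hmt le_top ht x
  obtain ⟨hGmem, hGle⟩ := eLpNorm_integral_gradDiv_Ioi_two_le hgb hN hgt hK hdiv ht
  have hVmem : MemLp (heatExtension gt t) 2 volume := memLp_heatExtension_holds hgt one_le_two ht
  have hVle : eLpNorm (heatExtension gt t) 2 volume ≤ eLpNorm gt 2 volume := eLpNorm_heatExtension_le_holds hgt one_le_two ht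
  refine ⟨fun x => by rw [hadd]; abel, hVmem.sub hGmem, ?_⟩
  calc eLpNorm (fun x => heatExtension gt t x -
        ∫ σ in Ioi t, gradient (VectorCalculus.divergence (heatExtension gb σ)) x) 2 volume
      ≤ eLpNorm (heatExtension gt t) 2 volume +
          eLpNorm (fun x => ∫ σ in Ioi t, gradient (VectorCalculus.divergence (heatExtension gb σ)) x) 2 volume :=
        eLpNorm_sub_le hVmem.1 hGmem.1 one_le_two
    _ ≤ eLpNorm gt 2 volume +
          ENNReal.ofReal (2 * (‖(traceCLM : (EuclideanSpace ℝ (Fin 3) →L[ℝ] EuclideanSpace ℝ (Fin 3)) →L[ℝ] ℝ)‖ ^ 2 + 1)) *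
            eLpNorm gt 2 volume := add_le_add hVle hGle
    _ = ENNReal.ofReal (2 * ‖(traceCLM : (EuclideanSpace ℝ (Fin 3) →L[ℝ] EuclideanSpace ℝ (Fin 3)) →L[ℝ] ℝ)‖ ^ 2 + 3) *
          eLpNorm gt 2 volume := by
        rw [show (2 : ℝ) * ‖(traceCLM : (EuclideanSpace ℝ (Fin 3) →L[ℝ] EuclideanSpace ℝ (Fin 3)) →L[ℝ] ℝ)‖ ^ 2 + 3 =
            1 + 2 * (‖(traceCLM : (EuclideanSpace ℝ (Fin 3) →L[ℝ] EuclideanSpace ℝ (Fin 3)) →L[ℝ] ℝ)‖ ^ 2 + 1) by ring,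
          ENNReal.ofReal_add zero_le_one (by positivity), ENNReal.ofReal_one]
        ring

end Field

end Literature.Analysis.FluidPDE

end
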